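import Summits.ValiantsHypothesis.ValiantsHypothesis.Theorems.BarrierLeverAnchoredDoorHitsLowerPairsMultiSpec

/-!
# Support item `AnchoredDoorHitsLowerPairs` (stmt-ValiantsHypothesis-22510), line `anchored-peeling`:
# the WEIGHTED MULTI-ANCHOR SPECIALISATION and its entry formula (toward the registered `Stmt.stub_uqFaceStep`, general gap)

Helper file (`--supports stmt-ValiantsHypothesis-22510`; cell valiant-natproofs, rung V4, 𝒟-side door (c); registered line
`Cruxes/AnchoredDoorHitsLowerPairs/Lines/anchored_peeling.lean` v13; prover seat val-np-p1 gen 20). Closes NO item.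
DESIGN (replaces modules B2b–B4 of HOME/val-np-p1/g19/QSTEP-BLUEPRINT-valnp1-g19.md ADDENDUM 3 and removes its CAVEAT). In the general-gap
face-target UQ step the `m` private anchors `α_A = (ρ A | F)` ALL HAVE THE SAME TARGET FACE `F`, so (1) a square-free reading uses AT MOST ONE
of them (two would need `y_F²`): no mixed terms (`prod_one_add_monomial_mul`, `prod_map_wSpecHom_symbFactor`); (2) ONE polynomial variable `T`
suffices, anchor `α ∈ 𝔅` going to `T^{wt α}` with an INTEGER WEIGHT (`θ_α ↦ T^{wt α}`, `φ_{α b} ↦ T^{wt α}` on `P α` else `0`, `ψ_{α d} ↦ T^{wt α}`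
on `Q α` else `0`; other parameters constant): `wStarSpec`, `wSpecHom`, entry formula `coeff_map_wSpecHom_symbolicWitness`
`[x^S y^T] wSpec(𝔄) = C L°[S,T] + Σ_{α ∈ 𝔅} Σ_{Z ⊆ P α, W ⊆ Q α} [α.1 ∪ Z ⊆ S ∧ α.2 ∪ W ⊆ T] · T^{wt α (|Z|+|W|+1)} · L°[S ∖ (α.1 ∪ Z), T ∖ (α.2 ∪ W)]`
(`L°` = layout of `symbRestSet s h 𝔅`, `restSetEntry`), with degree bound / designated top coefficient / constancy off the target
(`natDegree_wSpecHom_coeff_le`, `coeff_wSpecHom_coeff_top`, `wSpecHom_coeff_eq_C`) and `restSetEntry_empty` (`L°[∅, T] = [T = ∅]`). With row-dependent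
weights the univariate `coeff_det_of_natDegree_le_row` (file `…StarSpec`) then extracts the private coefficient (sequel files).

WHAT THIS IS NOT: no determinant statement yet; nothing on crux stmt-ValiantsHypothesis-14610 or on `VP` versus `VNP`.
-/

set_option linter.dupNamespace false

namespace Summit.ValiantsHypothesis.ValiantsHypothesis.Theorems.BarrierLever.AnchoredPeeling

open Finset MvPolynomial
open Summit.ValiantsHypothesis.ValiantsHypothesis.Theorems.BarrierLever.BrickCalculus (pexpo pexpo_def pexpo_le_iff pexpo_sub
  pexpo_apply_natAdd pexpo_apply_castAdd)

noncomputable section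

/-! ## 1. Generic: the entry shape `C c₀ + Σ_{α ∈ 𝔅} Σ_{Z ⊆ P α} Σ_{W ⊆ Q α} [cond] · monomial (deg α Z W) (c α Z W)` -/

section Generic

variable {A : Type*} [CommRing A] {ι β : Type*}

/-- Degree bound for the three-level entry shape: if every switched-on term has degree `≤ B`, so has the entry. -/
theorem natDegree_entry₃_le (c₀ : A) (𝔅 : Finset ι) (P Q : ι → Finset β) (cond : ι → Finset β → Finset β → Prop)
    [∀ α Z W, Decidable (cond α Z W)] (deg : ι → Finset β → Finset β → ℕ) (c : ι → Finset β → Finset β → A) (B : ℕ)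
    (hB : ∀ α ∈ 𝔅, ∀ Z ∈ (P α).powerset, ∀ W ∈ (Q α).powerset, cond α Z W → deg α Z W ≤ B) :
    (Polynomial.C c₀ + ∑ α ∈ 𝔅, ∑ Z ∈ (P α).powerset, ∑ W ∈ (Q α).powerset,
        (if cond α Z W then Polynomial.monomial (deg α Z W) (c α Z W) else 0)).natDegree ≤ B := by
  refine (Polynomial.natDegree_add_le _ _).trans (max_le (by rw [Polynomial.natDegree_C]; exact Nat.zero_le _) ?_)
  refine Polynomial.natDegree_sum_le_of_forall_le _ _ (fun α hα => Polynomial.natDegree_sum_le_of_forall_le _ _ (fun Z hZ =>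
    Polynomial.natDegree_sum_le_of_forall_le _ _ (fun W hW => ?_)))
  split_ifs with hc
  · exact (Polynomial.natDegree_monomial_le _).trans (hB α hα Z hZ W hW hc)
  · rw [Polynomial.natDegree_zero]; exact Nat.zero_le _

/-- Coefficient of the three-level entry shape at a positive degree `B`: the sum of the switched-on terms of degree exactly `B`. -/
theorem coeff_entry₃ (c₀ : A) (𝔅 : Finset ι) (P Q : ι → Finset β) (cond : ι → Finset β → Finset β → Prop)
    [∀ α Z W, Decidable (cond α Z W)] (deg : ι → Finset β → Finset β → ℕ) (c : ι → Finset β → Finset β → A) {B : ℕ}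
    (hB : B ≠ 0) :
    (Polynomial.C c₀ + ∑ α ∈ 𝔅, ∑ Z ∈ (P α).powerset, ∑ W ∈ (Q α).powerset,
        (if cond α Z W then Polynomial.monomial (deg α Z W) (c α Z W) else 0)).coeff B =
      ∑ α ∈ 𝔅, ∑ Z ∈ (P α).powerset, ∑ W ∈ (Q α).powerset,
        (if cond α Z W ∧ deg α Z W = B then c α Z W else 0) := by
  rw [Polynomial.coeff_add, Polynomial.coeff_C, if_neg hB, zero_add, Polynomial.finsetSum_coeff]
  refine Finset.sum_congr rfl (fun α _ => ?_)
  rw [Polynomial.finsetSum_coeff]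
  refine Finset.sum_congr rfl (fun Z _ => ?_)
  rw [Polynomial.finsetSum_coeff]; refine Finset.sum_congr rfl (fun W _ => ?_)
  by_cases hc : cond α Z W
  · rw [if_pos hc, Polynomial.coeff_monomial]
    by_cases hd : deg α Z W = B
    · rw [if_pos hd, if_pos ⟨hc, hd⟩]
    · rw [if_neg hd, if_neg (fun h' => hd h'.2)]
  · rw [if_neg hc, Polynomial.coeff_zero, if_neg (fun h' => hc h'.1)]

/-- **Top coefficient, one designated term.** If the designated term `(α₀, P α₀, Q α₀)` is the only switched-on term that can reach degree
`B ≠ 0`, the coefficient at `B` is that term (or `0` if it is switched off). -/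
theorem coeff_entry₃_top (c₀ : A) (𝔅 : Finset ι) (P Q : ι → Finset β) (cond : ι → Finset β → Finset β → Prop)
    [∀ α Z W, Decidable (cond α Z W)] (deg : ι → Finset β → Finset β → ℕ) (c : ι → Finset β → Finset β → A) {B : ℕ}
    (hB : B ≠ 0) {α₀ : ι} (hα₀ : α₀ ∈ 𝔅) (hdeg₀ : deg α₀ (P α₀) (Q α₀) = B)
    (honly : ∀ α ∈ 𝔅, ∀ Z ∈ (P α).powerset, ∀ W ∈ (Q α).powerset, cond α Z W → deg α Z W = B → α = α₀ ∧ Z = P α₀ ∧ W = Q α₀) :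
    (Polynomial.C c₀ + ∑ α ∈ 𝔅, ∑ Z ∈ (P α).powerset, ∑ W ∈ (Q α).powerset,
        (if cond α Z W then Polynomial.monomial (deg α Z W) (c α Z W) else 0)).coeff B =
      if cond α₀ (P α₀) (Q α₀) then c α₀ (P α₀) (Q α₀) else 0 := by
  rw [coeff_entry₃ c₀ 𝔅 P Q cond deg c hB, Finset.sum_eq_single α₀]
  · rw [Finset.sum_eq_single (P α₀)]
    · rw [Finset.sum_eq_single (Q α₀)]
      · by_cases hc : cond α₀ (P α₀) (Q α₀)
        · rw [if_pos ⟨hc, hdeg₀⟩, if_pos hc]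
        · rw [if_neg (fun h' => hc h'.1), if_neg hc]
      · intro W hW hne
        rw [if_neg]
        rintro ⟨hc, hd⟩
        exact hne (honly α₀ hα₀ _ (Finset.mem_powerset.mpr subset_rfl) W hW hc hd).2.2
      · intro h'; exact absurd (Finset.mem_powerset.mpr subset_rfl) h'
    · intro Z hZ hne
      refine Finset.sum_eq_zero (fun W hW => ?_)
      rw [if_neg]
      rintro ⟨hc, hd⟩
      exact hne (honly α₀ hα₀ Z hZ W hW hc hd).2.1
    · intro h'; exact absurd (Finset.mem_powerset.mpr subset_rfl) h'
  · intro α hα hne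
    refine Finset.sum_eq_zero (fun Z hZ => Finset.sum_eq_zero (fun W hW => ?_))
    rw [if_neg]
    rintro ⟨hc, hd⟩
    exact hne (honly α hα Z hZ W hW hc hd).1
  · intro h'; exact absurd hα₀ h'

/-- **Shared monomial ⇒ no mixed terms.** If every `Y α` is divisible by the monomial `x^{m₀}`, then
`∏ (1 + Y α) = 1 + Σ Y α + x^{2 m₀} · R` for some `R`. -/
theorem prod_one_add_monomial_mul {σ R : Type*} [CommSemiring R] (𝔅 : Finset ι) (m₀ : σ →₀ ℕ)
    (Y' : ι → MvPolynomial σ R) :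
    ∃ Rm : MvPolynomial σ R, ∏ α ∈ 𝔅, (1 + monomial m₀ 1 * Y' α) =
      1 + ∑ α ∈ 𝔅, monomial m₀ 1 * Y' α + monomial (m₀ + m₀) 1 * Rm := by
  classical
  induction 𝔅 using Finset.induction_on with
  | empty => exact ⟨0, by simp⟩
  | insert a s ha ih =>
    obtain ⟨Rm, hRm⟩ := ih
    refine ⟨Rm + Y' a * ∑ α ∈ s, Y' α + monomial m₀ 1 * Y' a * Rm, ?_⟩
    rw [Finset.prod_insert ha, Finset.sum_insert ha, hRm, ← Finset.mul_sum]
    have hmm : (monomial (m₀ + m₀) (1 : R) : MvPolynomial σ R) = monomial m₀ 1 * monomial m₀ 1 := by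
      rw [monomial_mul, one_mul]
    rw [hmm]
    ring

end Generic

/-! ## 2. The weighted specialisation map -/

variable {h : ℕ}

/-- The weighted one-variable specialisation of the parameters of a SET `𝔅` of anchors: anchor `α ∈ 𝔅` goes to `T^{wt α}` (twists scaled on
`P α`, `Q α`, killed elsewhere), all other parameters become constants of `ℂ[θ,φ,ψ][T]`. -/
def wStarSpec (𝔅 : Finset (Finset (Fin h) × Finset (Fin h))) (P Q : Finset (Fin h) × Finset (Fin h) → Finset (Fin h))
    (wt : Finset (Fin h) × Finset (Fin h) → ℕ) : Param h → Polynomial (MvPolynomial (Param h) ℂ)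
  | Sum.inl α => if α ∈ 𝔅 then Polynomial.X ^ wt α else Polynomial.C (X (Sum.inl α))
  | Sum.inr (Sum.inl (α, b)) =>
      if α ∈ 𝔅 then (if b ∈ P α then Polynomial.X ^ wt α else 0) else Polynomial.C (X (Sum.inr (Sum.inl (α, b))))
  | Sum.inr (Sum.inr (α, d)) =>
      if α ∈ 𝔅 then (if d ∈ Q α then Polynomial.X ^ wt α else 0) else Polynomial.C (X (Sum.inr (Sum.inr (α, d))))

/-- The weighted specialisation as a ring map `ℂ[θ,φ,ψ] → ℂ[θ,φ,ψ][T]`. -/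
def wSpecHom (𝔅 : Finset (Finset (Fin h) × Finset (Fin h))) (P Q : Finset (Fin h) × Finset (Fin h) → Finset (Fin h))
    (wt : Finset (Fin h) × Finset (Fin h) → ℕ) : MvPolynomial (Param h) ℂ →+* Polynomial (MvPolynomial (Param h) ℂ) :=
  (aeval (wStarSpec 𝔅 P Q wt)).toRingHom

/-- The specialisation on a parameter variable. -/
theorem wSpecHom_X (𝔅 : Finset (Finset (Fin h) × Finset (Fin h))) (P Q : Finset (Fin h) × Finset (Fin h) → Finset (Fin h))
    (wt : Finset (Fin h) × Finset (Fin h) → ℕ) (v : Param h) :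
    wSpecHom 𝔅 P Q wt (X v) = wStarSpec 𝔅 P Q wt v := by
  rw [wSpecHom, AlgHom.toRingHom_eq_coe, RingHom.coe_coe, aeval_X]

variable (𝔅 : Finset (Finset (Fin h) × Finset (Fin h))) (P Q : Finset (Fin h) × Finset (Fin h) → Finset (Fin h))
  (wt : Finset (Fin h) × Finset (Fin h) → ℕ)

/-- Anchors outside `𝔅`: their factor is unchanged (its parameters become constants). -/
theorem map_wSpecHom_symbFactor_of_not_mem {α : Finset (Fin h) × Finset (Fin h)} (hα : α ∉ 𝔅) :
    MvPolynomial.map (wSpecHom 𝔅 P Q wt) (symbFactor h α) = MvPolynomial.map Polynomial.C (symbFactor h α) := by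
  rw [symbFactor]
  simp only [map_add, map_one, map_mul, map_prod, map_C, map_X, wSpecHom_X, wStarSpec, if_neg hα]

/-- The rest (factors outside `𝔅`) is unchanged by the specialisation. -/
theorem map_wSpecHom_symbRestSet (s h : ℕ) (𝔅 : Finset (Finset (Fin h) × Finset (Fin h)))
    (P Q : Finset (Fin h) × Finset (Fin h) → Finset (Fin h)) (wt : Finset (Fin h) × Finset (Fin h) → ℕ) :
    MvPolynomial.map (wSpecHom 𝔅 P Q wt) (symbRestSet s h 𝔅) = MvPolynomial.map Polynomial.C (symbRestSet s h 𝔅) := by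
  rw [symbRestSet, map_prod, map_prod]
  exact Finset.prod_congr rfl (fun α hα => map_wSpecHom_symbFactor_of_not_mem 𝔅 P Q wt (Finset.mem_sdiff.mp hα).2)

/-- **The specialised factor of an anchor in `𝔅`**: `1 + Σ_{Z ⊆ P α, W ⊆ Q α} T^{wt α · (|Z|+|W|+1)} · x^{α.1 ∪ Z} y^{α.2 ∪ W}`. -/
theorem map_wSpecHom_symbFactor_of_mem {α : Finset (Fin h) × Finset (Fin h)} (hα : α ∈ 𝔅)
    (hP : P α ⊆ univ \ α.1) (hQ : Q α ⊆ univ \ α.2) :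
    MvPolynomial.map (wSpecHom 𝔅 P Q wt) (symbFactor h α) =
      1 + ∑ Z ∈ (P α).powerset, ∑ W ∈ (Q α).powerset,
        C (Polynomial.X ^ (wt α * (Z.card + W.card + 1))) * monomial (pexpo (α.1 ∪ Z) (α.2 ∪ W)) 1 := by
  classical
  rw [symbFactor]
  simp only [map_add, map_one, map_mul, map_prod, map_C, map_X, wSpecHom_X, wStarSpec, if_pos hα]
  rw [prod_twist_ite (Polynomial.X ^ wt α) hP, prod_twist_ite (Polynomial.X ^ wt α) hQ, prod_one_add_C_mul_X,
    prod_one_add_C_mul_X, mul_assoc _ (∑ Z ∈ (P α).powerset, _) (∑ W ∈ (Q α).powerset, _), Finset.sum_mul_sum, Finset.mul_sum]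
  congr 1
  refine Finset.sum_congr rfl (fun Z hZ => ?_)
  rw [Finset.mul_sum]
  refine Finset.sum_congr rfl (fun W hW => ?_)
  have hdA : Disjoint α.1 Z :=
    Finset.disjoint_of_subset_right (Finset.mem_powerset.mp hZ) (Finset.disjoint_of_subset_right hP Finset.disjoint_sdiff)
  have hdB : Disjoint α.2 W :=
    Finset.disjoint_of_subset_right (Finset.mem_powerset.mp hW) (Finset.disjoint_of_subset_right hQ Finset.disjoint_sdiff)
  calc _ = (C ((Polynomial.X ^ wt α) ^ Z.card) * C ((Polynomial.X ^ wt α) ^ W.card) * C (Polynomial.X ^ wt α)) *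
          (((∏ a ∈ α.1, X (Fin.castAdd h a)) * ∏ b ∈ Z, X (Fin.castAdd h b)) *
           ((∏ c ∈ α.2, X (Fin.natAdd h c)) * ∏ d ∈ W, X (Fin.natAdd h d))) := by ring
    _ = C (Polynomial.X ^ (wt α * (Z.card + W.card + 1))) * monomial (pexpo (α.1 ∪ Z) (α.2 ∪ W)) 1 := by
        rw [← Finset.prod_union hdA, ← Finset.prod_union hdB, prod_X_eq_monomial', prod_X_eq_monomial',
          monomial_mul, mul_one, ← pexpo_def, ← map_mul, ← map_mul, ← pow_add, ← pow_succ, ← pow_mul]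

/-! ## 3. The reduced layout `L°` of `symbRestSet` -/

/-- The layout entries `L°[S,T] = [x^S y^T] symbRestSet s h 𝔅` of the witness without the factors of `𝔅`. -/
def restSetEntry (s h : ℕ) (𝔅 : Finset (Finset (Fin h) × Finset (Fin h))) (S T : Finset (Fin h)) : MvPolynomial (Param h) ℂ :=
  coeff (pexpo S T) (symbRestSet s h 𝔅)

/-- A product of anchor factors, read off the support of each of its anchors, does not change a square-free coefficient. -/
theorem coeff_prod_symbFactor_mul_of_not (𝔖 : Finset (Finset (Fin h) × Finset (Fin h)))
    (g : MvPolynomial (Fin (h + h)) (MvPolynomial (Param h) ℂ)) (S T : Finset (Fin h))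
    (hnot : ∀ α ∈ 𝔖, ¬ (α.1 ⊆ S ∧ α.2 ⊆ T)) :
    coeff (pexpo S T) ((∏ α ∈ 𝔖, symbFactor h α) * g) = coeff (pexpo S T) g := by
  classical
  induction 𝔖 using Finset.induction_on generalizing g with
  | empty => rw [Finset.prod_empty, one_mul]
  | insert a s ha ih =>
    rw [Finset.prod_insert ha, mul_assoc, symbFactor_eq, add_mul, one_mul, coeff_add, mul_assoc, coeff_monomial_mul',
      if_neg (fun hle => hnot a (Finset.mem_insert_self a s) ((pexpo_le_iff _ _ _ _).mp hle)), add_zero]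
    exact ih g (fun α hα => hnot α (Finset.mem_insert_of_mem hα))

/-- **Off the support of every anchor of `𝔅` the full and the reduced layouts agree.** -/
theorem coeff_symbolicWitness_eq_restSet (s h : ℕ) {𝔅 : Finset (Finset (Fin h) × Finset (Fin h))} (h𝔅 : 𝔅 ⊆ anchors s h)
    (S T : Finset (Fin h)) (hnot : ∀ α ∈ 𝔅, ¬ (α.1 ⊆ S ∧ α.2 ⊆ T)) :
    coeff (pexpo S T) (symbolicWitness s h) = restSetEntry s h 𝔅 S T := by
  rw [restSetEntry, symbolicWitness_eq_prod_mul_rest s h h𝔅]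
  exact coeff_prod_symbFactor_mul_of_not 𝔅 _ S T hnot

/-- A product of anchor factors (nonempty `x`-parts) has no `x`-free monomial except `1`. -/
theorem coeff_pexpo_empty_prod_symbFactor {s : ℕ} (𝔖 : Finset (Finset (Fin h) × Finset (Fin h))) (h𝔖 : 𝔖 ⊆ anchors s h)
    (T : Finset (Fin h)) :
    coeff (pexpo (∅ : Finset (Fin h)) T) (∏ α ∈ 𝔖, symbFactor h α) = if T = ∅ then 1 else 0 := by
  classical
  have key : coeff (pexpo (∅ : Finset (Fin h)) T) ((∏ α ∈ 𝔖, symbFactor h α) * 1) =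
      coeff (pexpo (∅ : Finset (Fin h)) T) (1 : MvPolynomial (Fin (h + h)) (MvPolynomial (Param h) ℂ)) := by
    refine coeff_prod_symbFactor_mul_of_not 𝔖 1 ∅ T (fun α hα hsub => ?_)
    have hA : 1 ≤ α.1.card := by
      have := h𝔖 hα
      rw [anchors, Finset.mem_filter] at this
      exact this.2.1
    obtain ⟨a, ha⟩ := Finset.card_pos.mp hA
    exact Finset.notMem_empty a (hsub.1 ha)
  rw [mul_one] at key
  rw [key, ← C_1, coeff_C]
  by_cases hT : T = ∅
  · rw [if_pos hT, hT, if_pos]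
    rw [pexpo_def, Finset.sum_empty, Finset.sum_empty, add_zero]
  · rw [if_neg hT, if_neg]
    intro h0
    obtain ⟨c, hc⟩ := Finset.nonempty_iff_ne_empty.mpr hT
    have := congrArg (fun m => m (Fin.natAdd h c)) h0
    simp only [Finsupp.coe_zero, Pi.zero_apply, pexpo_apply_natAdd, if_pos hc] at this
    exact one_ne_zero this.symm

/-- **`L°[∅, T] = [T = ∅]`.** -/
theorem restSetEntry_empty (s h : ℕ) (𝔅 : Finset (Finset (Fin h) × Finset (Fin h))) (T : Finset (Fin h)) :
    restSetEntry s h 𝔅 ∅ T = if T = ∅ then 1 else 0 := by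
  rw [restSetEntry, symbRestSet]; exact coeff_pexpo_empty_prod_symbFactor (anchors s h \ 𝔅) Finset.sdiff_subset T

/-! ## 4. The entry formula -/

/-- The specialised witness: the product of the specialised `𝔅`-factors times the constant rest. -/
theorem map_wSpecHom_symbolicWitness (s h : ℕ) {𝔅 : Finset (Finset (Fin h) × Finset (Fin h))} (h𝔅 : 𝔅 ⊆ anchors s h)
    (P Q : Finset (Fin h) × Finset (Fin h) → Finset (Fin h)) (wt : Finset (Fin h) × Finset (Fin h) → ℕ) :
    MvPolynomial.map (wSpecHom 𝔅 P Q wt) (symbolicWitness s h) =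
      (∏ α ∈ 𝔅, MvPolynomial.map (wSpecHom 𝔅 P Q wt) (symbFactor h α)) * MvPolynomial.map Polynomial.C (symbRestSet s h 𝔅) := by
  rw [symbolicWitness_eq_prod_mul_rest s h h𝔅, map_mul, map_prod, map_wSpecHom_symbRestSet]

/-- The product of the specialised factors of a set of anchors with a COMMON target face `F`: no mixed terms modulo `y_F²`. -/
theorem prod_map_wSpecHom_symbFactor {𝔅 : Finset (Finset (Fin h) × Finset (Fin h))} {F : Finset (Fin h)} (h2 : ∀ α ∈ 𝔅, α.2 = F)
    {P Q : Finset (Fin h) × Finset (Fin h) → Finset (Fin h)} (hP : ∀ α ∈ 𝔅, P α ⊆ univ \ α.1) (hQ : ∀ α ∈ 𝔅, Q α ⊆ univ \ α.2)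
    (wt : Finset (Fin h) × Finset (Fin h) → ℕ) :
    ∃ Rm : MvPolynomial (Fin (h + h)) (Polynomial (MvPolynomial (Param h) ℂ)),
      (∏ α ∈ 𝔅, MvPolynomial.map (wSpecHom 𝔅 P Q wt) (symbFactor h α)) =
        1 + (∑ α ∈ 𝔅, ∑ Z ∈ (P α).powerset, ∑ W ∈ (Q α).powerset,
              C (Polynomial.X ^ (wt α * (Z.card + W.card + 1))) * monomial (pexpo (α.1 ∪ Z) (α.2 ∪ W)) 1) +
          monomial (pexpo (∅ : Finset (Fin h)) F + pexpo (∅ : Finset (Fin h)) F) 1 * Rm := by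
  classical
  -- the specialised factors are `1 + y^F · Y' α`
  let Y' : Finset (Fin h) × Finset (Fin h) → MvPolynomial (Fin (h + h)) (Polynomial (MvPolynomial (Param h) ℂ)) := fun α =>
    ∑ Z ∈ (P α).powerset, ∑ W ∈ (Q α).powerset,
      C (Polynomial.X ^ (wt α * (Z.card + W.card + 1))) * monomial (pexpo (α.1 ∪ Z) W) 1
  have hmm : ∀ e : Fin (h + h) →₀ ℕ,
      (monomial (pexpo (∅ : Finset (Fin h)) F) (1 : Polynomial (MvPolynomial (Param h) ℂ)) * monomial e 1 :
          MvPolynomial (Fin (h + h)) (Polynomial (MvPolynomial (Param h) ℂ))) =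
        monomial (pexpo (∅ : Finset (Fin h)) F + e) 1 := fun e => by
    rw [monomial_mul, one_mul]
  have hsplit : ∀ α ∈ 𝔅, ∀ Z W : Finset (Fin h), Disjoint F W →
      pexpo (α.1 ∪ Z) (α.2 ∪ W) = pexpo (∅ : Finset (Fin h)) F + pexpo (α.1 ∪ Z) W := by
    intro α hα Z W hdW
    rw [h2 α hα]
    have := pexpo_union (A := (∅ : Finset (Fin h))) (Z := α.1 ∪ Z) (B := F) (W := W) (Finset.disjoint_empty_left _) hdW
    rwa [Finset.empty_union] at this
  have hYY' : ∀ α ∈ 𝔅,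
      (∑ Z ∈ (P α).powerset, ∑ W ∈ (Q α).powerset,
          C (Polynomial.X ^ (wt α * (Z.card + W.card + 1))) * monomial (pexpo (α.1 ∪ Z) (α.2 ∪ W)) 1 :
            MvPolynomial (Fin (h + h)) (Polynomial (MvPolynomial (Param h) ℂ))) =
        monomial (pexpo (∅ : Finset (Fin h)) F) 1 * Y' α := by
    intro α hα
    simp only [Y', Finset.mul_sum]
    refine Finset.sum_congr rfl (fun Z _ => Finset.sum_congr rfl (fun W hW => ?_))
    have hdW : Disjoint F W := by
      rw [← h2 α hα]
      exact Finset.disjoint_of_subset_right (Finset.mem_powerset.mp hW)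
        (Finset.disjoint_of_subset_right (hQ α hα) Finset.disjoint_sdiff)
    rw [hsplit α hα Z W hdW, ← hmm, mul_left_comm]
  have hfac : ∀ α ∈ 𝔅, MvPolynomial.map (wSpecHom 𝔅 P Q wt) (symbFactor h α) = 1 + monomial (pexpo (∅ : Finset (Fin h)) F) 1 * Y' α := by
    intro α hα
    rw [map_wSpecHom_symbFactor_of_mem 𝔅 P Q wt hα (hP α hα) (hQ α hα), hYY' α hα]
  obtain ⟨Rm, hRm⟩ := prod_one_add_monomial_mul 𝔅 (pexpo (∅ : Finset (Fin h)) F) Y'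
  refine ⟨Rm, ?_⟩
  rw [Finset.prod_congr rfl hfac, hRm]
  congr 2
  exact Finset.sum_congr rfl (fun α hα => (hYY' α hα).symm)

/-- A multiple of `y_F²` (`F ≠ ∅`) has no square-free readings. -/
theorem coeff_pexpo_monomial_two_mul {R : Type*} [CommSemiring R] {F : Finset (Fin h)} (hF : F.Nonempty)
    (g : MvPolynomial (Fin (h + h)) R) (S T : Finset (Fin h)) :
    coeff (pexpo S T) (monomial (pexpo (∅ : Finset (Fin h)) F + pexpo (∅ : Finset (Fin h)) F) 1 * g) = 0 := by
  classical
  rw [coeff_monomial_mul', if_neg]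
  intro hle
  obtain ⟨c, hc⟩ := hF
  have := Finsupp.le_def.mp hle (Fin.natAdd h c)
  simp only [Finsupp.coe_add, Pi.add_apply, pexpo_apply_natAdd, if_pos hc] at this
  split_ifs at this <;> omega

/-- **Entry formula for a set of anchors with a COMMON nonempty target face.** If every `α ∈ 𝔅 ⊆ anchors` has `α.2 = F ≠ ∅`, then
`[x^S y^T] wSpec(symbolicWitness) = C L°[S,T] + Σ_{α ∈ 𝔅} Σ_{Z ⊆ P α, W ⊆ Q α} [α.1 ∪ Z ⊆ S ∧ α.2 ∪ W ⊆ T] · T^{wt α (|Z|+|W|+1)} · L°[S ∖ (α.1 ∪ Z), T ∖ (α.2 ∪ W)]`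
(no mixed terms: two anchors of `𝔅` would need `y_F²`). -/
theorem coeff_map_wSpecHom_symbolicWitness (s h : ℕ) {𝔅 : Finset (Finset (Fin h) × Finset (Fin h))} (h𝔅 : 𝔅 ⊆ anchors s h)
    {F : Finset (Fin h)} (hF : F.Nonempty) (h2 : ∀ α ∈ 𝔅, α.2 = F)
    {P Q : Finset (Fin h) × Finset (Fin h) → Finset (Fin h)} (hP : ∀ α ∈ 𝔅, P α ⊆ univ \ α.1) (hQ : ∀ α ∈ 𝔅, Q α ⊆ univ \ α.2)
    (wt : Finset (Fin h) × Finset (Fin h) → ℕ) (S T : Finset (Fin h)) :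
    coeff (pexpo S T) (MvPolynomial.map (wSpecHom 𝔅 P Q wt) (symbolicWitness s h)) =
      Polynomial.C (restSetEntry s h 𝔅 S T) +
        ∑ α ∈ 𝔅, ∑ Z ∈ (P α).powerset, ∑ W ∈ (Q α).powerset,
          (if α.1 ∪ Z ⊆ S ∧ α.2 ∪ W ⊆ T then
            Polynomial.monomial (wt α * (Z.card + W.card + 1)) (restSetEntry s h 𝔅 (S \ (α.1 ∪ Z)) (T \ (α.2 ∪ W)))
          else 0) := by
  classical
  simp only [restSetEntry]
  obtain ⟨Rm, hprod⟩ := prod_map_wSpecHom_symbFactor h2 hP hQ wt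
  have hmixed : coeff (pexpo S T) (monomial (pexpo (∅ : Finset (Fin h)) F + pexpo (∅ : Finset (Fin h)) F) 1 * Rm *
      MvPolynomial.map Polynomial.C (symbRestSet s h 𝔅)) = 0 := by
    rw [mul_assoc]; exact coeff_pexpo_monomial_two_mul hF _ S T
  rw [map_wSpecHom_symbolicWitness s h h𝔅 P Q wt, hprod, add_mul, add_mul, one_mul, coeff_add, coeff_add, hmixed, add_zero,
    coeff_map, add_right_inj]
  rw [Finset.sum_mul, coeff_sum]
  refine Finset.sum_congr rfl (fun α _ => ?_)
  rw [Finset.sum_mul, coeff_sum]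
  refine Finset.sum_congr rfl (fun Z _ => ?_)
  rw [Finset.sum_mul, coeff_sum]
  refine Finset.sum_congr rfl (fun W _ => ?_)
  rw [mul_assoc, coeff_C_mul, coeff_monomial_mul']
  by_cases hle : α.1 ∪ Z ⊆ S ∧ α.2 ∪ W ⊆ T
  · rw [if_pos ((pexpo_le_iff _ _ _ _).mpr hle), if_pos hle, one_mul, pexpo_sub _ _ _ _ hle.1 hle.2, coeff_map,
      mul_comm, Polynomial.C_mul_X_pow_eq_monomial]
  · rw [if_neg (fun h' => hle ((pexpo_le_iff _ _ _ _).mp h')), if_neg hle, mul_zero]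

/-! ## 5. Consequences for single entries -/

section Entry

variable {s : ℕ} {𝔅 : Finset (Finset (Fin h) × Finset (Fin h))} {F : Finset (Fin h)}
  {P Q : Finset (Fin h) × Finset (Fin h) → Finset (Fin h)} {wt : Finset (Fin h) × Finset (Fin h) → ℕ}

/-- Off the target face the specialised entry is the constant original entry. -/
theorem wSpecHom_coeff_eq_C (h𝔅 : 𝔅 ⊆ anchors s h) (hF : F.Nonempty) (h2 : ∀ α ∈ 𝔅, α.2 = F)
    (hP : ∀ α ∈ 𝔅, P α ⊆ univ \ α.1) (hQ : ∀ α ∈ 𝔅, Q α ⊆ univ \ α.2) (S T : Finset (Fin h)) (hT : ¬ F ⊆ T) :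
    wSpecHom 𝔅 P Q wt (coeff (pexpo S T) (symbolicWitness s h)) = Polynomial.C (coeff (pexpo S T) (symbolicWitness s h)) := by
  have hnot : ∀ α ∈ 𝔅, ¬ (α.1 ⊆ S ∧ α.2 ⊆ T) := fun α hα hsub => hT (by rw [← h2 α hα]; exact hsub.2)
  rw [← MvPolynomial.coeff_map, coeff_map_wSpecHom_symbolicWitness s h h𝔅 hF h2 hP hQ wt S T,
    coeff_symbolicWitness_eq_restSet s h h𝔅 S T hnot, Finset.sum_eq_zero (fun α hα => ?_), add_zero]
  refine Finset.sum_eq_zero (fun Z _ => Finset.sum_eq_zero (fun W _ => ?_))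
  rw [if_neg]
  exact fun hZW => hnot α hα ⟨Finset.union_subset_left hZW.1, Finset.union_subset_left hZW.2⟩

/-- Degree bound of a specialised entry: a bound `B` valid for every anchor of `𝔅` that fits into `(S, T)` with some twist sets. -/
theorem natDegree_wSpecHom_coeff_le (h𝔅 : 𝔅 ⊆ anchors s h) (hF : F.Nonempty) (h2 : ∀ α ∈ 𝔅, α.2 = F)
    (hP : ∀ α ∈ 𝔅, P α ⊆ univ \ α.1) (hQ : ∀ α ∈ 𝔅, Q α ⊆ univ \ α.2) (S T : Finset (Fin h)) (B : ℕ)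
    (hB : ∀ α ∈ 𝔅, ∀ Z ⊆ P α, ∀ W ⊆ Q α, α.1 ∪ Z ⊆ S → α.2 ∪ W ⊆ T → wt α * (Z.card + W.card + 1) ≤ B) :
    (wSpecHom 𝔅 P Q wt (coeff (pexpo S T) (symbolicWitness s h))).natDegree ≤ B := by
  classical
  rw [← MvPolynomial.coeff_map, coeff_map_wSpecHom_symbolicWitness s h h𝔅 hF h2 hP hQ wt S T]
  exact natDegree_entry₃_le _ 𝔅 P Q (fun α Z W => α.1 ∪ Z ⊆ S ∧ α.2 ∪ W ⊆ T) (fun α Z W => wt α * (Z.card + W.card + 1))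
    (fun α Z W => restSetEntry s h 𝔅 (S \ (α.1 ∪ Z)) (T \ (α.2 ∪ W))) B
    (fun α hα Z hZ W hW hc => hB α hα Z (Finset.mem_powerset.mp hZ) W (Finset.mem_powerset.mp hW) hc.1 hc.2)

/-- **Top coefficient of a specialised entry, one designated anchor.** If `α₀ ∈ 𝔅` with full twist sets is the only fitting term of degree
`B = wt α₀ · (|P α₀| + |Q α₀| + 1) ≠ 0`, the coefficient at `B` is `[α₀.1 ∪ P α₀ ⊆ S ∧ α₀.2 ∪ Q α₀ ⊆ T] · L°[S ∖ (α₀.1 ∪ P α₀), T ∖ (α₀.2 ∪ Q α₀)]`. -/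
theorem coeff_wSpecHom_coeff_top (h𝔅 : 𝔅 ⊆ anchors s h) (hF : F.Nonempty) (h2 : ∀ α ∈ 𝔅, α.2 = F)
    (hP : ∀ α ∈ 𝔅, P α ⊆ univ \ α.1) (hQ : ∀ α ∈ 𝔅, Q α ⊆ univ \ α.2) (S T : Finset (Fin h)) {B : ℕ} (hB : B ≠ 0)
    {α₀ : Finset (Fin h) × Finset (Fin h)} (hα₀ : α₀ ∈ 𝔅) (hdeg₀ : wt α₀ * ((P α₀).card + (Q α₀).card + 1) = B)
    (honly : ∀ α ∈ 𝔅, ∀ Z ⊆ P α, ∀ W ⊆ Q α, α.1 ∪ Z ⊆ S → α.2 ∪ W ⊆ T → wt α * (Z.card + W.card + 1) = B →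
      α = α₀ ∧ Z = P α₀ ∧ W = Q α₀) :
    (wSpecHom 𝔅 P Q wt (coeff (pexpo S T) (symbolicWitness s h))).coeff B =
      if α₀.1 ∪ P α₀ ⊆ S ∧ α₀.2 ∪ Q α₀ ⊆ T then restSetEntry s h 𝔅 (S \ (α₀.1 ∪ P α₀)) (T \ (α₀.2 ∪ Q α₀)) else 0 := by
  classical
  rw [← MvPolynomial.coeff_map, coeff_map_wSpecHom_symbolicWitness s h h𝔅 hF h2 hP hQ wt S T]
  exact coeff_entry₃_top _ 𝔅 P Q (fun α Z W => α.1 ∪ Z ⊆ S ∧ α.2 ∪ W ⊆ T) (fun α Z W => wt α * (Z.card + W.card + 1))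
    (fun α Z W => restSetEntry s h 𝔅 (S \ (α.1 ∪ Z)) (T \ (α.2 ∪ W))) hB hα₀ hdeg₀
    (fun α hα Z hZ W hW hc hd => honly α hα Z (Finset.mem_powerset.mp hZ) W (Finset.mem_powerset.mp hW) hc.1 hc.2 hd)

end Entry

end

end Summit.ValiantsHypothesis.ValiantsHypothesis.Theorems.BarrierLever.AnchoredPeeling
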